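import Summits.CriticalPhenomena.PercolationContinuityZ3.Theorems.FK.RandomClusterFiniteEnergy
import Literature.Probability.LatticeModels.RandomClusterEdgeWeightsRatio
import HarnessLib

/-!
# FK-continuity transplant, FO-10 seat B: two-sided finite energy in the EDGE-WEIGHTS form
# (`φ^B_{𝐩,q} = rcMeasureW w q B`, Grimmett 2006 eq. (1.20) with Thm. (3.1) eq. (3.4), Thm. (4.17)(b))

Cell `fk-continuity` (bschramm), registry row FO-10b; support file of the FK-continuity transplant
(`--supports stmt-CriticalPhenomena-4575`, helper); builds on p205010 (kernel theorem, internal audit signed;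
external expert review pending). No definitions, no named facts, no sorries; standard axioms. Companion of
row FO-06b's `RandomClusterFiniteEnergy.lean` (p242692: the same two tolerances for the HOMOGENEOUS measure
`rcMeasure G p q B`, imported, not re-proved): here the measure is the edge-parameter measure `rcMeasureW w q B`
on ALL pairs of a finite vertex type (`RandomClusterEdgeWeights.lean`), the shape of every conditioned / pinned
law of the transplant (`rcMeasureW (condWeights w F ξ) q B`, Grimmett Thm. (3.7); `fkLaw Λ W q`): revealed-open
pairs carry weight `1`, revealed-closed ones `0`, fresh ones `p` — hence PER-EDGE constants throughout.

Grimmett 2006, Thm. (3.1)(a) eqs. (3.3)–(3.4) (pp. 37–38), read with edge parameters (p. 317): for `q ≥ 1` the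
conditional probability that the pair `e` is open given the states of all other pairs lies in
`[w_e/(w_e + q(1 - w_e)), w_e]`. Contents (every wired set `B`, event `A`, pair `e`, finite set `F` of pairs):

* `coe_mul_weight_eq_of_notMem` — the toggling identity `w_e · W(ω) = (1 - w_e) · W(ω ∪ {e})` (`e ∉ ω`);
* `coe_mul_rcWeightW_le_insert`, `sub_mul_rcWeightW_le_sdiff` — opening (closing) a pair costs at most the factor
  `q(1 - w_e)/w_e` (`w_e/(1 - w_e)`) in weight (cluster counts move by at most one);
* `mul_sum_ind_preimage_insert_le`, `mul_sum_ind_preimage_sdiff_le` — the summation step, for ANY nonnegative...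
  in fact any weight function with the one-pair toggling inequality (reusable for other tilted laws);
* `rcMeasureW_coe_mul_real_preimage_insert_le` — **one-pair insertion tolerance, sharp form**:
  `w_e · φ{ω | ω ∪ {e} ∈ A} ≤ (w_e + q(1 - w_e)) · φ(A ∩ {e open})`;
* `rcMeasureW_sub_mul_real_preimage_sdiff_le` — **one-pair deletion tolerance, sharp form**:
  `(1 - w_e) · φ{ω | ω ∖ {e} ∈ A} ≤ φ(A ∩ {e closed})`;
* `rcMeasureW_prod_mul_real_preimage_union_le` — `(∏_{e ∈ F} w_e/(w_e + q(1 - w_e))) · φ{ω | ω ∪ F ∈ A} ≤ φ(A)`;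
* `rcMeasureW_prod_mul_real_preimage_sdiff_le` — `(∏_{e ∈ F} (1 - w_e)) · φ{ω | ω ∖ F ∈ A} ≤ φ(A)`;
* CONSTANT-WEIGHT corollaries `rcMeasureW_pow_mul_real_preimage_union_le` / `…_sdiff_le` (`w_e = p` on `F`:
  `(p/(p + q(1-p)))^{|F|}`, `(1-p)^{|F|}`) and `…_of_le` (weights bounded on `F`), in exactly the hypothesis shape
  `hins` / `hdel` of the transplant's measure-generic Kozma–Nitzan steps (`KNFree.tolerance_union_map_liftEdges`,
  `KNFree.tolerance_sdiff_map_liftEdges` in `Transplant/KNFreeSeedsLift.lean`; `KNFreeSeedsEnergy.lean`).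

The conditional two-sided bounds for events determined off `F`, pattern bounds and quasi-independence
`q^{-|F|} φ(A)φ(C) ≤ φ(A ∩ C) ≤ q^{|F|} φ(A)φ(C)` follow in the companion file `ConditionalEnergyDetermined.lean`.

## References

* G. Grimmett, *The Random-Cluster Model*, Springer 2006: §1.4 eq. (1.20) (p. 15); Thm. (3.1)(a), eqs. (3.3)–(3.4)
  (pp. 37–38); Thm. (3.7) (p. 39); Thm. (4.17)(b) (p. 75); §11.4 p. 317. [Grimmett2006]
-/

noncomputable section

open MeasureTheory Finset
open scoped ENNReal Classical

namespace Summit.CriticalPhenomena.PercolationContinuityZ3.Theorems.FK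

open Literature.Probability.Percolation Literature.Probability.LatticeModels
open Literature.Probability.Percolation.BHK2006 (weight weight_nonneg ind_inter)
open Literature.Probability.Percolation.DecisionTree (ind ind_of_mem ind_of_not_mem ind_nonneg)

variable {V : Type*} [Fintype V] (w : Sym2 V → unitInterval)

/-! ### Pointwise: toggling one pair -/

/-- **The toggling identity of the product weight**: for `e ∉ ω`, `w_e · W(ω) = (1 - w_e) · W(ω ∪ {e})` (the two
configurations differ only in the factor at `e`). [cite: Grimmett2006, §1.4 eq. (1.20) (p. 15)] -/
theorem coe_mul_weight_eq_of_notMem {ω : BondConfig V} {e : Sym2 V} (he : e ∉ ω) :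
    (w e : ℝ) * weight (fun f => (w f : ℝ)) ω = (1 - w e) * weight (fun f => (w f : ℝ)) (insert e ω) := by
  -- the product of the factors off `e`, as a function of the configuration (instance-stable under substitution)
  set R : BondConfig V → ℝ := fun η => ∏ f ∈ Finset.univ.erase e, (if f ∈ η then (w f : ℝ) else 1 - w f)
    with hR
  have hfac : ∀ η : BondConfig V,
      weight (fun f => (w f : ℝ)) η = (if e ∈ η then (w e : ℝ) else 1 - w e) * R η := fun η =>
    (Finset.mul_prod_erase Finset.univ (fun f => if f ∈ η then (w f : ℝ) else 1 - w f) (Finset.mem_univ e)).symm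
  have hRins : R (insert e ω) = R ω := Finset.prod_congr rfl fun f hf => by
    have hfe : f ≠ e := Finset.ne_of_mem_erase hf
    simp only [Set.mem_insert_iff, hfe, false_or]
  rw [hfac ω, hfac (insert e ω), hRins, if_neg he, if_pos (Set.mem_insert e ω)]
  ring

/-- **Opening one pair costs at most the factor `q(1 - w_e)/w_e` in weight** (the cluster count drops by at most
one): for `e ∉ ω`, `q ≥ 1`, `w_e · w^B_{𝐩,q}(ω) ≤ q(1 - w_e) · w^B_{𝐩,q}(ω ∪ {e})`.
[cite: Grimmett2006, Thm. (3.1)(a) eq. (3.3) (p. 37)] -/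
theorem coe_mul_rcWeightW_le_insert {q : ℝ} (hq : 1 ≤ q) (B : Set V) {ω : BondConfig V} {e : Sym2 V}
    (he : e ∉ ω) :
    (w e : ℝ) * rcWeightW w q B ω ≤ q * (1 - w e) * rcWeightW w q B (insert e ω) := by
  unfold rcWeightW
  have h1 : q ^ clusterCount ω B ≤ q ^ (clusterCount (insert e ω) B + 1) :=
    pow_le_pow_right₀ hq (clusterCount_le_clusterCount_insert_edge_add_one ω e B)
  have h0 : 0 ≤ (w e : ℝ) * weight (fun f => (w f : ℝ)) ω :=
    mul_nonneg (w e).2.1 (weight_nonneg (fun f => (w f).2.1) (fun f => (w f).2.2) ω)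
  calc (w e : ℝ) * (weight (fun f => (w f : ℝ)) ω * q ^ clusterCount ω B)
      = ((w e : ℝ) * weight (fun f => (w f : ℝ)) ω) * q ^ clusterCount ω B := by ring
    _ ≤ ((w e : ℝ) * weight (fun f => (w f : ℝ)) ω) * q ^ (clusterCount (insert e ω) B + 1) :=
        mul_le_mul_of_nonneg_left h1 h0
    _ = q * (1 - w e) * (weight (fun f => (w f : ℝ)) (insert e ω) * q ^ clusterCount (insert e ω) B) := by
        rw [coe_mul_weight_eq_of_notMem w he, pow_succ]; ring

/-- **Closing one pair costs at most the factor `w_e/(1 - w_e)` in weight** (the cluster count can only go up):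
for `e ∈ ω`, `q ≥ 1`, `(1 - w_e) · w^B_{𝐩,q}(ω) ≤ w_e · w^B_{𝐩,q}(ω ∖ {e})`. [cite: Grimmett2006, Thm. (3.1)(a) eq. (3.3) (p. 37)] -/
theorem sub_mul_rcWeightW_le_sdiff {q : ℝ} (hq : 1 ≤ q) (B : Set V) {ω : BondConfig V} {e : Sym2 V}
    (he : e ∈ ω) :
    (1 - (w e : ℝ)) * rcWeightW w q B ω ≤ (w e : ℝ) * rcWeightW w q B (ω \ {e}) := by
  have key := coe_mul_weight_eq_of_notMem w (show e ∉ ω \ {e} from fun h => h.2 rfl)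
  rw [Set.insert_sdiff_self_of_mem he] at key
  unfold rcWeightW
  have h1 : q ^ clusterCount ω B ≤ q ^ clusterCount (ω \ {e}) B :=
    pow_le_pow_right₀ hq (clusterCount_anti Set.sdiff_subset B)
  have h0 : 0 ≤ (w e : ℝ) * weight (fun f => (w f : ℝ)) (ω \ {e}) :=
    mul_nonneg (w e).2.1 (weight_nonneg (fun f => (w f).2.1) (fun f => (w f).2.2) _)
  calc (1 - (w e : ℝ)) * (weight (fun f => (w f : ℝ)) ω * q ^ clusterCount ω B)
      = ((1 - (w e : ℝ)) * weight (fun f => (w f : ℝ)) ω) * q ^ clusterCount ω B := by ring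
    _ = ((w e : ℝ) * weight (fun f => (w f : ℝ)) (ω \ {e})) * q ^ clusterCount ω B := by rw [key]
    _ ≤ ((w e : ℝ) * weight (fun f => (w f : ℝ)) (ω \ {e})) * q ^ clusterCount (ω \ {e}) B :=
        mul_le_mul_of_nonneg_left h1 h0
    _ = _ := by ring

/-! ### The summation step (any weight function with the one-pair toggling inequality) -/

/-- Reindexing the configurations NOT containing `e` by `ω ↦ ω ∪ {e}` enumerates those containing `e`. [folklore] -/
theorem sum_filter_notMem_insert (e : Sym2 V) (f : BondConfig V → ℝ) :
    ∑ ω ∈ Finset.univ.filter (fun ω : BondConfig V => e ∉ ω), f (insert e ω) =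
      ∑ η ∈ Finset.univ.filter (fun η : BondConfig V => e ∈ η), f η := by
  refine Finset.sum_nbij' (fun ω => insert e ω) (fun η => η \ {e}) ?_ ?_ ?_ ?_ ?_
  · intro ω _; simp
  · intro η _; simp
  · intro ω hω
    exact Set.insert_sdiff_self_of_notMem (by simpa using hω)
  · intro η hη
    exact Set.insert_sdiff_self_of_mem (by simpa using hη)
  · intro ω _; rfl

/-- **Summation step, insertion**: if `c · g(ω) ≤ c' · g(ω ∪ {e})` whenever `e ∉ ω`, then for every event `A`,
`c · ∑_ω g(ω) 1{ω ∪ {e} ∈ A} ≤ (c + c') · ∑_ω g(ω) 1{ω ∈ A, e ∈ ω}`. [cite: Grimmett2006, Thm. (3.1)(a) eq. (3.4) (p. 38)] -/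
theorem mul_sum_ind_preimage_insert_le (g : BondConfig V → ℝ) (e : Sym2 V) {c c' : ℝ}
    (htog : ∀ ω : BondConfig V, e ∉ ω → c * g ω ≤ c' * g (insert e ω)) (A : Set (BondConfig V)) :
    c * ∑ ω, g ω * ind {ω : BondConfig V | insert e ω ∈ A} ω ≤
      (c + c') * ∑ ω, g ω * ind (A ∩ {ω | e ∈ ω}) ω := by
  set T : Set (BondConfig V) := {ω | insert e ω ∈ A} with hT
  set U₁ := Finset.univ.filter (fun ω : BondConfig V => e ∈ ω) with hU₁
  set U₂ := Finset.univ.filter (fun ω : BondConfig V => ¬ e ∈ ω) with hU₂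
  have hsplit : ∀ f : BondConfig V → ℝ, ∑ ω, f ω = ∑ ω ∈ U₁, f ω + ∑ ω ∈ U₂, f ω := fun f =>
    (Finset.sum_filter_add_sum_filter_not Finset.univ (fun ω : BondConfig V => e ∈ ω) f).symm
  -- membership in `T` does not depend on the state of `e`
  have hTins : ∀ ω : BondConfig V, ind T (insert e ω) = ind T ω := fun ω => by
    have : insert e ω ∈ T ↔ ω ∈ T := by simp [hT]
    by_cases h : ω ∈ T
    · rw [ind_of_mem h, ind_of_mem (this.2 h)]
    · rw [ind_of_not_mem h, ind_of_not_mem (mt this.1 h)]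
  -- on `U₁`: `ω ∈ T ↔ ω ∈ A ∩ {e ∈ ω}`; on `U₂` the indicator of `A ∩ {e ∈ ω}` vanishes
  have h1 : ∑ ω ∈ U₁, g ω * ind T ω = ∑ ω ∈ U₁, g ω * ind (A ∩ {ω | e ∈ ω}) ω := by
    refine Finset.sum_congr rfl fun ω hω => ?_
    have he : e ∈ ω := (Finset.mem_filter.1 hω).2
    have : ω ∈ T ↔ ω ∈ A ∩ {ω | e ∈ ω} := by simp [hT, Set.insert_eq_of_mem he, he]
    by_cases h : ω ∈ T
    · rw [ind_of_mem h, ind_of_mem (this.1 h)]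
    · rw [ind_of_not_mem h, ind_of_not_mem (mt this.2 h)]
  have h2 : ∑ ω ∈ U₂, g ω * ind (A ∩ {ω | e ∈ ω}) ω = 0 :=
    Finset.sum_eq_zero fun ω hω => by
      rw [ind_of_not_mem (fun h => (Finset.mem_filter.1 hω).2 h.2), mul_zero]
  have h3 : c * ∑ ω ∈ U₂, g ω * ind T ω ≤ c' * ∑ ω ∈ U₁, g ω * ind T ω := by
    rw [← sum_filter_notMem_insert e (fun η => g η * ind T η), Finset.mul_sum, Finset.mul_sum]
    refine Finset.sum_le_sum fun ω hω => ?_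
    rw [hTins ω, ← mul_assoc, ← mul_assoc]
    exact mul_le_mul_of_nonneg_right (htog ω (Finset.mem_filter.1 hω).2) (ind_nonneg _ _)
  rw [hsplit (fun ω => g ω * ind T ω), hsplit (fun ω => g ω * ind (A ∩ {ω | e ∈ ω}) ω), h2, add_zero, ← h1,
    mul_add, add_mul]
  linarith [h3]

/-- Reindexing the configurations containing `e` by `ω ↦ ω ∖ {e}` enumerates those not containing `e`. [folklore] -/
theorem sum_filter_mem_sdiff (e : Sym2 V) (f : BondConfig V → ℝ) :
    ∑ ω ∈ Finset.univ.filter (fun ω : BondConfig V => e ∈ ω), f (ω \ {e}) =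
      ∑ η ∈ Finset.univ.filter (fun η : BondConfig V => e ∉ η), f η := by
  refine Finset.sum_nbij' (fun ω => ω \ {e}) (fun η => insert e η) ?_ ?_ ?_ ?_ ?_
  · intro ω _; simp
  · intro η _; simp
  · intro ω hω
    exact Set.insert_sdiff_self_of_mem (by simpa using hω)
  · intro η hη
    exact Set.insert_sdiff_self_of_notMem (by simpa using hη)
  · intro ω _; rfl

/-- **Summation step, deletion**: if `c · g(ω) ≤ c' · g(ω ∖ {e})` whenever `e ∈ ω`, then for every event `A`,
`c · ∑_ω g(ω) 1{ω ∖ {e} ∈ A} ≤ (c' + c) · ∑_ω g(ω) 1{ω ∈ A, e ∉ ω}`. [cite: Grimmett2006, Thm. (3.1)(a) eq. (3.4) (p. 38)] -/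
theorem mul_sum_ind_preimage_sdiff_le (g : BondConfig V → ℝ) (e : Sym2 V) {c c' : ℝ}
    (htog : ∀ ω : BondConfig V, e ∈ ω → c * g ω ≤ c' * g (ω \ {e})) (A : Set (BondConfig V)) :
    c * ∑ ω, g ω * ind {ω : BondConfig V | ω \ {e} ∈ A} ω ≤
      (c' + c) * ∑ ω, g ω * ind (A ∩ {ω | e ∉ ω}) ω := by
  set S : Set (BondConfig V) := {ω | ω \ {e} ∈ A} with hS
  set U₁ := Finset.univ.filter (fun ω : BondConfig V => e ∈ ω) with hU₁
  set U₂ := Finset.univ.filter (fun ω : BondConfig V => ¬ e ∈ ω) with hU₂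
  have hsplit : ∀ f : BondConfig V → ℝ, ∑ ω, f ω = ∑ ω ∈ U₁, f ω + ∑ ω ∈ U₂, f ω := fun f =>
    (Finset.sum_filter_add_sum_filter_not Finset.univ (fun ω : BondConfig V => e ∈ ω) f).symm
  have hSdel : ∀ ω : BondConfig V, ind S (ω \ {e}) = ind S ω := fun ω => by
    have : ω \ {e} ∈ S ↔ ω ∈ S := by simp [hS]
    by_cases h : ω ∈ S
    · rw [ind_of_mem h, ind_of_mem (this.2 h)]
    · rw [ind_of_not_mem h, ind_of_not_mem (mt this.1 h)]
  have h1 : ∑ ω ∈ U₂, g ω * ind S ω = ∑ ω ∈ U₂, g ω * ind (A ∩ {ω | e ∉ ω}) ω := by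
    refine Finset.sum_congr rfl fun ω hω => ?_
    have he : e ∉ ω := (Finset.mem_filter.1 hω).2
    have : ω ∈ S ↔ ω ∈ A ∩ {ω | e ∉ ω} := by simp [hS, Set.sdiff_singleton_eq_self he, he]
    by_cases h : ω ∈ S
    · rw [ind_of_mem h, ind_of_mem (this.1 h)]
    · rw [ind_of_not_mem h, ind_of_not_mem (mt this.2 h)]
  have h2 : ∑ ω ∈ U₁, g ω * ind (A ∩ {ω | e ∉ ω}) ω = 0 :=
    Finset.sum_eq_zero fun ω hω => by
      rw [ind_of_not_mem (fun h => h.2 (Finset.mem_filter.1 hω).2), mul_zero]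
  have h3 : c * ∑ ω ∈ U₁, g ω * ind S ω ≤ c' * ∑ ω ∈ U₂, g ω * ind S ω := by
    rw [← sum_filter_mem_sdiff e (fun η => g η * ind S η), Finset.mul_sum, Finset.mul_sum]
    refine Finset.sum_le_sum fun ω hω => ?_
    rw [hSdel ω, ← mul_assoc, ← mul_assoc]
    exact mul_le_mul_of_nonneg_right (htog ω (Finset.mem_filter.1 hω).2) (ind_nonneg _ _)
  rw [hsplit (fun ω => g ω * ind S ω), hsplit (fun ω => g ω * ind (A ∩ {ω | e ∉ ω}) ω), h2, zero_add, ← h1,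
    mul_add, add_mul]
  linarith [h3]

/-! ### One pair: the two tolerances -/

/-- **One-pair insertion tolerance in the weights form, sharp** (Grimmett 2006, (3.4) integrated): for `q ≥ 1`,
every wired set `B`, pair `e` and event `A`, `w_e · φ{ω | ω ∪ {e} ∈ A} ≤ (w_e + q(1 - w_e)) · φ(A ∩ {e open})`.
[cite: Grimmett2006, Thm. (3.1)(a) eq. (3.4) (p. 38); Thm. (4.17)(b) (p. 75)] -/
theorem rcMeasureW_coe_mul_real_preimage_insert_le {q : ℝ} (hq : 1 ≤ q) (B : Set V) (e : Sym2 V)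
    (A : Set (BondConfig V)) :
    (w e : ℝ) * (rcMeasureW w q B).real {ω | insert e ω ∈ A} ≤
      ((w e : ℝ) + q * (1 - w e)) * (rcMeasureW w q B).real (A ∩ {ω | e ∈ ω}) := by
  have hq0 : 0 < q := one_pos.trans_le hq
  have hZ := rcPartitionFunctionW_pos w hq0 B
  rw [rcMeasureW_real_eq_sum_div w hq0 B, rcMeasureW_real_eq_sum_div w hq0 B, mul_div_assoc', mul_div_assoc']
  exact div_le_div_of_nonneg_right (mul_sum_ind_preimage_insert_le (rcWeightW w q B) e
    (fun ω he => coe_mul_rcWeightW_le_insert w hq B he) A) hZ.le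

/-- **One-pair deletion tolerance in the weights form, sharp** (Grimmett 2006, (3.4) integrated): for `q ≥ 1`,
every wired set `B`, pair `e` and event `A`, `(1 - w_e) · φ{ω | ω ∖ {e} ∈ A} ≤ φ(A ∩ {e closed})`.
[cite: Grimmett2006, Thm. (3.1)(a) eq. (3.4) (p. 38); Thm. (4.17)(b) (p. 75)] -/
theorem rcMeasureW_sub_mul_real_preimage_sdiff_le {q : ℝ} (hq : 1 ≤ q) (B : Set V) (e : Sym2 V)
    (A : Set (BondConfig V)) :
    (1 - (w e : ℝ)) * (rcMeasureW w q B).real {ω | ω \ {e} ∈ A} ≤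
      (rcMeasureW w q B).real (A ∩ {ω | e ∉ ω}) := by
  have hq0 : 0 < q := one_pos.trans_le hq
  have hZ := rcPartitionFunctionW_pos w hq0 B
  rw [rcMeasureW_real_eq_sum_div w hq0 B, rcMeasureW_real_eq_sum_div w hq0 B, mul_div_assoc']
  refine div_le_div_of_nonneg_right ?_ hZ.le
  have h := mul_sum_ind_preimage_sdiff_le (rcWeightW w q B) e (fun ω he => sub_mul_rcWeightW_le_sdiff w hq B he) A
  rwa [show (w e : ℝ) + (1 - w e) = 1 by ring, one_mul] at h

omit [Fintype V] in
/-- `w_e + q(1 - w_e) ≥ 1 > 0` for `q ≥ 1`. [folklore] -/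
theorem insertionDenominatorW_pos {q : ℝ} (hq : 1 ≤ q) (e : Sym2 V) : 0 < (w e : ℝ) + q * (1 - w e) :=
  insertionDenominator_pos (w e).2 hq

/-- The insertion constant `p ↦ p/(p + q(1-p))` is monotone on `[0,1]` for `q ≥ 1`. [folklore] -/
theorem div_insertionDenominator_mono {q : ℝ} (hq : 1 ≤ q) {p p' : ℝ} (hp : p ∈ Set.Icc (0 : ℝ) 1)
    (hp' : p' ∈ Set.Icc (0 : ℝ) 1) (hpp : p ≤ p') :
    p / (p + q * (1 - p)) ≤ p' / (p' + q * (1 - p')) := by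
  rw [div_le_div_iff₀ (insertionDenominator_pos hp hq) (insertionDenominator_pos hp' hq)]
  nlinarith [hp.1, hp'.2]

/-- The insertion constant `p/(p + q(1-p))` lies in `[0, 1]` (`0 ≤ p ≤ 1`, `q ≥ 1`). [folklore] -/
theorem div_insertionDenominator_mem_Icc {q : ℝ} (hq : 1 ≤ q) {p : ℝ} (hp : p ∈ Set.Icc (0 : ℝ) 1) :
    p / (p + q * (1 - p)) ∈ Set.Icc (0 : ℝ) 1 := by
  have hD := insertionDenominator_pos hp hq
  refine ⟨div_nonneg hp.1 hD.le, (div_le_one hD).2 ?_⟩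
  nlinarith [hp.1, hp.2]

/-- **One-pair insertion tolerance, weights form**: `π_e · φ{ω | ω ∪ {e} ∈ A} ≤ φ(A)` with
`π_e = w_e/(w_e + q(1 - w_e))`. [cite: Grimmett2006, Thm. (3.1)(a) eq. (3.4) (p. 38)] -/
theorem rcMeasureW_div_mul_real_preimage_insert_le {q : ℝ} (hq : 1 ≤ q) (B : Set V) (e : Sym2 V)
    (A : Set (BondConfig V)) :
    (w e : ℝ) / ((w e : ℝ) + q * (1 - w e)) * (rcMeasureW w q B).real {ω | insert e ω ∈ A} ≤
      (rcMeasureW w q B).real A := by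
  haveI := isProbabilityMeasure_rcMeasureW w (one_pos.trans_le hq) B
  have hD := insertionDenominatorW_pos w hq e
  rw [div_mul_eq_mul_div, div_le_iff₀ hD, mul_comm ((rcMeasureW w q B).real A)]
  exact (rcMeasureW_coe_mul_real_preimage_insert_le w hq B e A).trans
    (mul_le_mul_of_nonneg_left (measureReal_mono Set.inter_subset_left) hD.le)

/-- **One-pair deletion tolerance, weights form**: `(1 - w_e) · φ{ω | ω ∖ {e} ∈ A} ≤ φ(A)`.
[cite: Grimmett2006, Thm. (3.1)(a) eq. (3.4) (p. 38)] -/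
theorem rcMeasureW_sub_mul_real_preimage_sdiff_le' {q : ℝ} (hq : 1 ≤ q) (B : Set V) (e : Sym2 V)
    (A : Set (BondConfig V)) :
    (1 - (w e : ℝ)) * (rcMeasureW w q B).real {ω | ω \ {e} ∈ A} ≤ (rcMeasureW w q B).real A := by
  haveI := isProbabilityMeasure_rcMeasureW w (one_pos.trans_le hq) B
  exact (rcMeasureW_sub_mul_real_preimage_sdiff_le w hq B e A).trans (measureReal_mono Set.inter_subset_left)

/-! ### Finitely many pairs -/

/-- **Insertion tolerance of `φ^B_{𝐩,q}` for finitely many pairs, per-edge constants**: for `q ≥ 1`, every wired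
set `B`, every finite set `F` of pairs and every event `A`,
`(∏_{e ∈ F} w_e/(w_e + q(1 - w_e))) · φ{ω | ω ∪ F ∈ A} ≤ φ(A)`. [cite: Grimmett2006, Thm. (3.1)(a) eq. (3.4) (p. 38); Thm. (4.17)(b) (p. 75)] -/
theorem rcMeasureW_prod_mul_real_preimage_union_le {q : ℝ} (hq : 1 ≤ q) (B : Set V) (F : Finset (Sym2 V))
    (A : Set (BondConfig V)) :
    (∏ e ∈ F, (w e : ℝ) / ((w e : ℝ) + q * (1 - w e))) *
        (rcMeasureW w q B).real ((fun ω => ω ∪ (↑F : Set (Sym2 V))) ⁻¹' A) ≤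
      (rcMeasureW w q B).real A := by
  induction F using Finset.induction_on generalizing A with
  | empty => simp
  | insert e F heF ih =>
    have hset : (fun ω : BondConfig V => ω ∪ (↑(insert e F) : Set (Sym2 V))) ⁻¹' A =
        (fun ω : BondConfig V => ω ∪ (↑F : Set (Sym2 V))) ⁻¹' {ω | insert e ω ∈ A} := by
      ext ω
      simp only [Set.mem_preimage, Set.mem_setOf_eq, Finset.coe_insert, Set.union_insert]
    rw [hset, Finset.prod_insert heF, mul_assoc]
    exact (mul_le_mul_of_nonneg_left (ih _) (div_insertionDenominator_mem_Icc hq (w e).2).1).trans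
      (rcMeasureW_div_mul_real_preimage_insert_le w hq B e A)

/-- **Deletion tolerance of `φ^B_{𝐩,q}` for finitely many pairs, per-edge constants**: for `q ≥ 1`, every wired
set `B`, every finite set `F` of pairs and every event `A`, `(∏_{e ∈ F} (1 - w_e)) · φ{ω | ω ∖ F ∈ A} ≤ φ(A)`.
[cite: Grimmett2006, Thm. (3.1)(a) eq. (3.4) (p. 38); Thm. (4.17)(b) (p. 75)] -/
theorem rcMeasureW_prod_mul_real_preimage_sdiff_le {q : ℝ} (hq : 1 ≤ q) (B : Set V) (F : Finset (Sym2 V))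
    (A : Set (BondConfig V)) :
    (∏ e ∈ F, (1 - (w e : ℝ))) * (rcMeasureW w q B).real ((fun ω => ω \ (↑F : Set (Sym2 V))) ⁻¹' A) ≤
      (rcMeasureW w q B).real A := by
  induction F using Finset.induction_on generalizing A with
  | empty => simp
  | insert e F heF ih =>
    have hset : (fun ω : BondConfig V => ω \ (↑(insert e F) : Set (Sym2 V))) ⁻¹' A =
        (fun ω : BondConfig V => ω \ (↑F : Set (Sym2 V))) ⁻¹' {ω | ω \ {e} ∈ A} := by
      ext ω
      have : ω \ (insert e (↑F : Set (Sym2 V))) = (ω \ ↑F) \ {e} := by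
        rw [← Set.union_singleton, Set.sdiff_sdiff]
      simp only [Set.mem_preimage, Set.mem_setOf_eq, Finset.coe_insert, this]
    rw [hset, Finset.prod_insert heF, mul_assoc]
    exact (mul_le_mul_of_nonneg_left (ih _) (sub_nonneg.2 (w e).2.2)).trans
      (rcMeasureW_sub_mul_real_preimage_sdiff_le' w hq B e A)

/-! ### Constant or bounded weight on `F`: the shape of the transplant's hypotheses `hins` / `hdel` -/

/-- **Insertion tolerance with constant weight `p` on `F`**: if `w_e = p` for every `e ∈ F` then
`(p/(p + q(1-p)))^{|F|} · φ{ω | ω ∪ F ∈ A} ≤ φ(A)` — the hypothesis `hins` of the transplant's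
`KNFree.real_manyContacts_diff_Gev_le` for the law `φ^B_{𝐩,q}`, before transport along `liftEdges`.
[cite: Grimmett2006, Thm. (3.1)(a) eq. (3.4) (p. 38); Thm. (4.17)(b) (p. 75)] -/
theorem rcMeasureW_pow_mul_real_preimage_union_le {q : ℝ} (hq : 1 ≤ q) (B : Set V) {p : ℝ}
    {F : Finset (Sym2 V)} (hF : ∀ e ∈ F, (w e : ℝ) = p) (A : Set (BondConfig V)) :
    (p / (p + q * (1 - p))) ^ F.card * (rcMeasureW w q B).real ((fun ω => ω ∪ (↑F : Set (Sym2 V))) ⁻¹' A) ≤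
      (rcMeasureW w q B).real A := by
  have hprod : ∏ e ∈ F, (w e : ℝ) / ((w e : ℝ) + q * (1 - w e)) = (p / (p + q * (1 - p))) ^ F.card := by
    rw [Finset.prod_congr rfl fun e he => by rw [hF e he], Finset.prod_const]
  simpa only [hprod] using rcMeasureW_prod_mul_real_preimage_union_le w hq B F A

/-- **Deletion tolerance with constant weight `p` on `F`**: if `w_e = p` for every `e ∈ F` then
`(1-p)^{|F|} · φ{ω | ω ∖ F ∈ A} ≤ φ(A)` — the hypothesis `hdel` of the transplant's `KNFree.stepII` for the law
`φ^B_{𝐩,q}`, before transport along `liftEdges`. [cite: Grimmett2006, Thm. (3.1)(a) eq. (3.4) (p. 38); Thm. (4.17)(b) (p. 75)] -/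
theorem rcMeasureW_pow_mul_real_preimage_sdiff_le {q : ℝ} (hq : 1 ≤ q) (B : Set V) {p : ℝ}
    {F : Finset (Sym2 V)} (hF : ∀ e ∈ F, (w e : ℝ) = p) (A : Set (BondConfig V)) :
    (1 - p) ^ F.card * (rcMeasureW w q B).real ((fun ω => ω \ (↑F : Set (Sym2 V))) ⁻¹' A) ≤
      (rcMeasureW w q B).real A := by
  have hprod : ∏ e ∈ F, (1 - (w e : ℝ)) = (1 - p) ^ F.card := by
    rw [Finset.prod_congr rfl fun e he => by rw [hF e he], Finset.prod_const]
  simpa only [hprod] using rcMeasureW_prod_mul_real_preimage_sdiff_le w hq B F A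

/-- **Insertion tolerance with weights bounded below on `F`**: if `p ≤ w_e` for every `e ∈ F` (`0 ≤ p ≤ 1`) then
`(p/(p + q(1-p)))^{|F|} · φ{ω | ω ∪ F ∈ A} ≤ φ(A)`. [cite: Grimmett2006, Thm. (3.1)(a) eq. (3.4) (p. 38)] -/
theorem rcMeasureW_pow_mul_real_preimage_union_le_of_le {q : ℝ} (hq : 1 ≤ q) (B : Set V) {p : ℝ}
    (hp : p ∈ Set.Icc (0 : ℝ) 1) {F : Finset (Sym2 V)} (hF : ∀ e ∈ F, p ≤ (w e : ℝ)) (A : Set (BondConfig V)) :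
    (p / (p + q * (1 - p))) ^ F.card * (rcMeasureW w q B).real ((fun ω => ω ∪ (↑F : Set (Sym2 V))) ⁻¹' A) ≤
      (rcMeasureW w q B).real A := by
  haveI := isProbabilityMeasure_rcMeasureW w (one_pos.trans_le hq) B
  have hle : (p / (p + q * (1 - p))) ^ F.card ≤ ∏ e ∈ F, (w e : ℝ) / ((w e : ℝ) + q * (1 - w e)) := by
    rw [← Finset.prod_const]
    exact Finset.prod_le_prod (fun e _ => (div_insertionDenominator_mem_Icc hq hp).1)
      fun e he => div_insertionDenominator_mono hq hp (w e).2 (hF e he)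
  exact (mul_le_mul_of_nonneg_right hle measureReal_nonneg).trans
    (rcMeasureW_prod_mul_real_preimage_union_le w hq B F A)

/-- **Deletion tolerance with weights bounded above on `F`**: if `w_e ≤ p ≤ 1` for every `e ∈ F` then
`(1-p)^{|F|} · φ{ω | ω ∖ F ∈ A} ≤ φ(A)`. [cite: Grimmett2006, Thm. (3.1)(a) eq. (3.4) (p. 38)] -/
theorem rcMeasureW_pow_mul_real_preimage_sdiff_le_of_le {q : ℝ} (hq : 1 ≤ q) (B : Set V) {p : ℝ} (hp1 : p ≤ 1)
    {F : Finset (Sym2 V)} (hF : ∀ e ∈ F, (w e : ℝ) ≤ p) (A : Set (BondConfig V)) :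
    (1 - p) ^ F.card * (rcMeasureW w q B).real ((fun ω => ω \ (↑F : Set (Sym2 V))) ⁻¹' A) ≤
      (rcMeasureW w q B).real A := by
  haveI := isProbabilityMeasure_rcMeasureW w (one_pos.trans_le hq) B
  have hle : (1 - p) ^ F.card ≤ ∏ e ∈ F, (1 - (w e : ℝ)) := by
    rw [← Finset.prod_const]
    exact Finset.prod_le_prod (fun e _ => sub_nonneg.2 hp1) fun e he => by linarith [hF e he]
  exact (mul_le_mul_of_nonneg_right hle measureReal_nonneg).trans
    (rcMeasureW_prod_mul_real_preimage_sdiff_le w hq B F A)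

end Summit.CriticalPhenomena.PercolationContinuityZ3.Theorems.FK

end
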